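import Literature.NumberTheory.ConnesConsani2021.QuantizedDiffFourierSide
import Literature.NumberTheory.ConnesConsani2021.FourierConjugateSchwartz
import Literature.NumberTheory.ConnesConsani2021.KernelApproxNumberBound
import HarnessLib

/-!
# `[H, f]` is of infinite order iff its frequency-side Hilbert–Schmidt conjugate is

RH-FREE operator theory (cell `rh-crit`, sub-cell cc, seat t13; the reduction step of the planned discharge of the
tree fact `CC2021_lemma_D47`, App. D Lemma D.1 (47) of Connes–Consani 2021: "`[H, f] = 𝔽_C[1_P, K]𝔽_C⁻¹` … one
just needs to show that `[1_P, K]` is an infinitesimal of infinite order", p. 33 L24–25).  Assembling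
`QuantizedDiffFourierSide` (the Schwartz matrix-coefficient identity) with `FourierConjugateSchwartz` (Fourier
conjugates are determined by Schwartz matrix coefficients; unitary invariance of approximation numbers): every
bounded operator `A` on `L²(ℝ)` acting a.e. by the kernel `k_f` of App. E (quantdiff) is of infinite order iff the
bounded operator `B` acting a.e. by the frequency kernel `K_B(ξ,η) = −2 f̂(ξ−η)(1_{ξ>0≥η} − 1_{ξ≤0<η})` is; and such a
`B` exists (`K_B ∈ L²(ℝ²)`, `exists_l2KernelOp_complex`).  What remains for Lemma 47 is therefore the separable
`L²`-approximation of `K_B` at a super-polynomial rate (`isInfiniteOrder_of_l2Kernel_approx`):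
`isInfiniteOrder_quantizedDiff_of_frequencyKernelApprox` states exactly this reduction (feed it to t4's
`CC2021_lemma_D47_iff_isInfiniteOrder.2`); it is NOT a discharge — the approximation hypothesis is explicit.
WHAT THIS IS NOT: any claim about RH.  Theorems only; no definition, no named fact (net debt 0).
-/

noncomputable section

open MeasureTheory Complex Set
open scoped Real FourierTransform

namespace Literature.NumberTheory.ConnesConsani2021

/-- RH-FREE. **Reduction of App. D Lemma 47 to the frequency side**: if `A` acts a.e. by `k_f` and `B` acts
a.e. by `K_B = −2 b_f`, then `A` is an infinitesimal of infinite order iff `B` is.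
[cite: ConnesConsani2021, App. D Lemma 47 proof p. 33 (arXiv chunk p0033:L24–26)] -/
theorem isInfiniteOrder_quantizedDiff_iff_fourierSide (f : SchwartzMap ℝ ℂ)
    (A B : Lp (α := ℝ) ℂ 2 →L[ℂ] Lp (α := ℝ) ℂ 2)
    (hA : ∀ φ : Lp (α := ℝ) ℂ 2, (A φ : ℝ → ℂ) =ᵐ[volume]
      fun s => ∫ t : ℝ, quantizedDiffKernel f s t * (φ : ℝ → ℂ) t)
    (hB : ∀ φ : Lp (α := ℝ) ℂ 2, (B φ : ℝ → ℂ) =ᵐ[volume]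
      fun ξ => ∫ η : ℝ, (-2) * (𝓕 (f : ℝ → ℂ) (ξ - η) *
        ((if 0 < ξ ∧ η ≤ 0 then (1 : ℂ) else 0) - (if ξ ≤ 0 ∧ 0 < η then (1 : ℂ) else 0))) *
          (φ : ℝ → ℂ) η) :
    IsInfiniteOrder A ↔ IsInfiniteOrder B := by
  refine isInfiniteOrder_iff_of_inner_schwartz A B fun φ ψ => ?_
  rw [MeasureTheory.L2.inner_def, MeasureTheory.L2.inner_def]
  have hφ := φ.coeFn_toLp 2 (volume : Measure ℝ)
  have hψ := ψ.coeFn_toLp 2 (volume : Measure ℝ)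
  have hFφ := (𝓕 φ).coeFn_toLp 2 (volume : Measure ℝ)
  have hFψ := (𝓕 ψ).coeFn_toLp 2 (volume : Measure ℝ)
  have hL : (fun s : ℝ => inner ℂ ((A (φ.toLp 2 (volume : Measure ℝ)) : ℝ → ℂ) s)
      ((ψ.toLp 2 (volume : Measure ℝ) : ℝ → ℂ) s)) =ᵐ[volume]
      fun s => (starRingEnd ℂ) (∫ t : ℝ, quantizedDiffKernel f s t * φ t) * ψ s := by
    filter_upwards [hA (φ.toLp 2 (volume : Measure ℝ)), hψ] with s hs hψs
    rw [RCLike.inner_apply, hs, hψs, integral_congr_ae (hφ.mono fun t ht => by rw [ht])]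
    exact mul_comm _ _
  have hR : (fun ξ : ℝ => inner ℂ ((B ((𝓕 φ).toLp 2 (volume : Measure ℝ)) : ℝ → ℂ) ξ)
      (((𝓕 ψ).toLp 2 (volume : Measure ℝ) : ℝ → ℂ) ξ)) =ᵐ[volume]
      fun ξ => (starRingEnd ℂ) (∫ η : ℝ, (-2) * (𝓕 (f : ℝ → ℂ) (ξ - η) *
        ((if 0 < ξ ∧ η ≤ 0 then (1 : ℂ) else 0) - (if ξ ≤ 0 ∧ 0 < η then (1 : ℂ) else 0))) *
          𝓕 (φ : ℝ → ℂ) η) * 𝓕 (ψ : ℝ → ℂ) ξ := by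
    filter_upwards [hB ((𝓕 φ).toLp 2 (volume : Measure ℝ)), hFψ] with ξ hξ hψξ
    rw [RCLike.inner_apply, hξ, hψξ,
      show ((𝓕 ψ : SchwartzMap ℝ ℂ) : ℝ → ℂ) ξ = 𝓕 (ψ : ℝ → ℂ) ξ from
        congrFun (SchwartzMap.fourier_coe ψ) ξ,
      integral_congr_ae (hFφ.mono fun η hη => by
        rw [hη, show ((𝓕 φ : SchwartzMap ℝ ℂ) : ℝ → ℂ) η = 𝓕 (φ : ℝ → ℂ) η from
          congrFun (SchwartzMap.fourier_coe φ) η])]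
    exact mul_comm _ _
  rw [integral_congr_ae hL, integral_congr_ae hR]
  exact integral_conj_quantizedDiff_mul_eq_fourierSide f φ ψ

/-- RH-FREE. **Existence of the frequency-side conjugate**: there is a bounded operator `B` on `L²(ℝ)` acting
a.e. by `K_B = −2 b_f` (`K_B ∈ L²(ℝ²)` by `memLp_two_quadrantKernel`; Reed–Simon VI.23), and for every bounded `A`
acting a.e. by `k_f`: `A` is of infinite order iff `B` is.
[cite: ConnesConsani2021, App. D Lemma 47 proof p. 33 (arXiv chunk p0033:L24–26); ReedSimonI1980, Thm. VI.23] -/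
theorem exists_fourierSide_op (f : SchwartzMap ℝ ℂ) :
    ∃ B : Lp (α := ℝ) ℂ 2 →L[ℂ] Lp (α := ℝ) ℂ 2,
      (∀ φ : Lp (α := ℝ) ℂ 2, (B φ : ℝ → ℂ) =ᵐ[volume]
        fun ξ => ∫ η : ℝ, (-2) * (𝓕 (f : ℝ → ℂ) (ξ - η) *
          ((if 0 < ξ ∧ η ≤ 0 then (1 : ℂ) else 0) - (if ξ ≤ 0 ∧ 0 < η then (1 : ℂ) else 0))) *
            (φ : ℝ → ℂ) η) ∧
      ∀ A : Lp (α := ℝ) ℂ 2 →L[ℂ] Lp (α := ℝ) ℂ 2,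
        (∀ φ : Lp (α := ℝ) ℂ 2, (A φ : ℝ → ℂ) =ᵐ[volume]
          fun s => ∫ t : ℝ, quantizedDiffKernel f s t * (φ : ℝ → ℂ) t) →
        (IsInfiniteOrder A ↔ IsInfiniteOrder B) := by
  have hK : MemLp (Function.uncurry fun ξ η : ℝ => (-2) * (𝓕 (f : ℝ → ℂ) (ξ - η) *
      ((if 0 < ξ ∧ η ≤ 0 then (1 : ℂ) else 0) - (if ξ ≤ 0 ∧ 0 < η then (1 : ℂ) else 0))))
      2 ((volume : Measure ℝ).prod volume) := by
    exact (memLp_two_quadrantKernel f).const_mul (-2 : ℂ)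
  obtain ⟨B, hB⟩ := exists_l2KernelOp_complex hK
  exact ⟨B, hB, fun A hA => isInfiniteOrder_quantizedDiff_iff_fourierSide f A B hA hB⟩

/-- RH-FREE. **App. D Lemma 47 from the direct kernel estimate**: if for every Schwartz `f` and every `k` the
frequency kernel `K_B = −2 f̂(ξ−η)(1_{ξ>0≥η} − 1_{ξ≤0<η})` is within `C_k (n+1)^{−k}` in `L²(ℝ²)` of a separable
kernel of rank `≤ n`, for all `n`, then every bounded operator acting a.e. by `k_f` is an infinitesimal of infinite
order — the second clause of the tree fact `CC2021_lemma_D47`, to which t4's `CC2021_lemma_D47_iff_isInfiniteOrder`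
(in `ArchimedeanTraceFormulaProofs`) reduces it: `CC2021_lemma_D47_iff_isInfiniteOrder.2 (isInfiniteOrder_quantizedDiff_of_frequencyKernelApprox h)`.
[cite: ConnesConsani2021, App. D Lemma 47 proof p. 33 (arXiv chunk p0033:L24–36) and Rem. 48 (L39–41)] -/
theorem isInfiniteOrder_quantizedDiff_of_frequencyKernelApprox
    (h : ∀ f : SchwartzMap ℝ ℂ, ∀ k : ℕ, ∃ C : ℝ, ∀ n : ℕ,
      ∃ a c : Fin n → Lp (α := ℝ) ℂ 2,
        Real.sqrt (∫ z : ℝ × ℝ, ‖(-2) * (𝓕 (f : ℝ → ℂ) (z.1 - z.2) *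
          ((if 0 < z.1 ∧ z.2 ≤ 0 then (1 : ℂ) else 0) - (if z.1 ≤ 0 ∧ 0 < z.2 then (1 : ℂ) else 0))) -
          ∑ i, (a i : ℝ → ℂ) z.1 * (starRingEnd ℂ) ((c i : ℝ → ℂ) z.2)‖ ^ 2 ∂((volume : Measure ℝ).prod volume))
          * ((n : ℝ) + 1) ^ k ≤ C)
    (f : SchwartzMap ℝ ℂ) (A : Lp (α := ℝ) ℂ 2 →L[ℂ] Lp (α := ℝ) ℂ 2)
    (hA : ∀ φ : Lp (α := ℝ) ℂ 2, (A φ : ℝ → ℂ) =ᵐ[volume]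
      fun s => ∫ t : ℝ, quantizedDiffKernel f s t * (φ : ℝ → ℂ) t) :
    IsInfiniteOrder A := by
  obtain ⟨B, hB, hiff⟩ := exists_fourierSide_op f
  have hK : MemLp (Function.uncurry fun ξ η : ℝ => (-2) * (𝓕 (f : ℝ → ℂ) (ξ - η) *
      ((if 0 < ξ ∧ η ≤ 0 then (1 : ℂ) else 0) - (if ξ ≤ 0 ∧ 0 < η then (1 : ℂ) else 0))))
      2 ((volume : Measure ℝ).prod volume) :=
    (memLp_two_quadrantKernel f).const_mul (-2 : ℂ)
  exact (hiff A hA).2 (isInfiniteOrder_of_l2Kernel_approx hK hB (h f))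

end Literature.NumberTheory.ConnesConsani2021
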